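import Literature.AlgebraicGeometry.Resolution.BlowupSNC
import Literature.AlgebraicGeometry.Motives.CartierDivisor
import Mathlib.AlgebraicGeometry.FunctionField

/-!
# Route `RadicialJung`, crux `CleanModelsSuffice`, line `Sketch`: the exceptionalisation GAME —
# definitions (the invariant `GameState`, its measures, admissible centres, the round contract)

Helper (definitions only) for the registered stub `stub_exceptionalise` of the skeleton of
`Summit.ResolutionOfSingularities.ResolutionOfSingularities.Theses.RadicialJung.CleanModelsSuffice`
(stmt-ResolutionOfSingularities-15883): a pointwise log-clean pair `(V, L)` (`V` regular, `L/K(V)`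
purely inseparable of degree `p`) is to be blown up, along regular centres having normal crossings
with everything, until the clean presentations are ADAPTED to a global boundary (the exceptional
divisors). Paper proof: `Cruxes/CleanModelsSuffice/Lines/Sketch.md` §1–4 and Appendix L.

* `GameState p V₀ L V π` — the INVARIANT of the game on the current model `π : V → V₀` (proper
  birational, `V` regular integral): the exceptional divisors created so far, `E : List` of ideal
  sheaves of `V` (creation order), and at every `v ∈ V` a presentation: a regular system of parameters
  `u v : Fin (d v) → 𝒪_{V,v}`, exponents `a v` (each `0` or prime to `p`), a unit `w v`, an injective
  labelling `lab v` of the members of `E` through `v` by coordinates (stalk ideal `(u_{lab D})` — the shape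
  of the tree's `HasSNCWith`), a generator `y v ∈ L ∖ K(V₀)` with `y^p = g v` and
  `π^* (g v) = w · ∏ u_i^{a_i}`, and the REG clause when no coordinate is charged. All data are
  stalk-local (no sections): consistency between neighbouring points is PROVED (intrinsic count of
  charged components via the singular locus of the normalisation; charge of a shared divisor).
* measures: `ch` (charged coordinates), `oldCh`/`mOld` (charged coordinates that are NOT exceptional),
  `chargedAt D v`, `expOf`, `oldExp`, `Nval` (the phase-2 resonance `min{n ≥ 1 | p ∣ e_D + n·a_H}`),
  the bad loci `W D` and the phase-2 potential `Φ`.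
* `Admissible S Z hZ I` — a closed `Z ⊆ V` which at each of its points is the coordinate subspace
  `V(u_I)` of at least two CHARGED coordinates (its reduced ideal sheaf has stalk `(u_i : i ∈ I)`).
* `RoundSpec S Z hZ I φ S'` — the contract of ONE ROUND (blow up `Z`): the new boundary is
  `E.map (strictTransformIdeal φ C) ++ [C·𝒪_{V'}]`, and the measures upstairs are controlled pointwise
  (off the centre: unchanged; over a phase-1 centre: `mOld` drops; over a phase-2 centre: the resonance
  of the new exceptional divisor is one less).
* `EndCond S` — the end state: `mOld ≤ 1` everywhere and no charged exceptional divisor meets `{mOld = 1}`.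
-/

noncomputable section

set_option linter.dupNamespace false -- mandated namespace of this single-conjunct summit

open CategoryTheory AlgebraicGeometry TopologicalSpace IsLocalRing
open Literature.AlgebraicGeometry.Resolution Literature.AlgebraicGeometry.Motives

namespace Summit.ResolutionOfSingularities.ResolutionOfSingularities.Theorems.RadicialJung.CleanModelsSuffice

/-! ## The invariant -/

/-- **State of the exceptionalisation game** on the model `π : V → V₀` for the degree-`p` purely
inseparable `L / K(V₀)`: the exceptional divisors so far (`E`, ideal sheaves of `V`, creation order) and,
at every point `v`, a log-clean presentation whose boundary part is LABELLED by the members of `E`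
through `v` — a regular system of parameters `u v`, exponents `a v` (`0` or prime to `p`), a unit `w v`,
`y v ∈ L ∖ K(V₀)` with `y^p = g v`, `π^*(g v) = w v · ∏ᵢ (u v i)^{a v i}` in `K(V)`, and the REG clause
(wound, or transversal to the boundary coordinates) when no coordinate is charged. [folklore] -/
structure GameState (p : ℕ) (V₀ : Scheme.{0}) [IsIntegral V₀] (L : Type) [Field L]
    [Algebra V₀.functionField L] (V : Scheme.{0}) [IsIntegral V] (π : V ⟶ V₀) [IsDominant π] where
  /-- the exceptional divisors created so far, in creation order -/
  E : List V.IdealSheafData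
  /-- the generator `y v ∈ L ∖ K(V₀)` of the presentation at `v` -/
  y : V → L
  /-- `g v = (y v)^p ∈ K(V₀)` -/
  g : V → V₀.functionField
  /-- `d v = emb dim 𝒪_{V,v} = dim 𝒪_{V,v}` -/
  d : V → ℕ
  /-- a regular system of parameters of `𝒪_{V,v}` -/
  u : ∀ v : V, Fin (d v) → V.presheaf.stalk v
  /-- the exponents (`0` = the coordinate does not enter the radicand) -/
  a : ∀ v : V, Fin (d v) → ℕ
  /-- the unit factor of the radicand -/
  w : ∀ v : V, V.presheaf.stalk v
  /-- the coordinate cutting out a member of `E` through `v` -/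
  lab : ∀ v : V, {D : V.IdealSheafData // D ∈ E ∧ v ∈ D.support} → Fin (d v)
  isRegular : ∀ v, IsRegularLocalRing (V.presheaf.stalk v)
  spanFinrank_eq : ∀ v, (maximalIdeal (V.presheaf.stalk v)).spanFinrank = d v
  span_u : ∀ v, Ideal.span (Set.range (u v)) = maximalIdeal (V.presheaf.stalk v)
  a_spec : ∀ v i, a v i = 0 ∨ ¬ p ∣ a v i
  isUnit_w : ∀ v, IsUnit (w v)
  lab_injective : ∀ v, Function.Injective (lab v)
  stalkIdeal_lab : ∀ v D, stalkIdeal D.1 v = Ideal.span {u v (lab v D)}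
  y_not_mem : ∀ v, y v ∉ Set.range (algebraMap V₀.functionField L)
  y_pow : ∀ v, algebraMap V₀.functionField L (g v) = y v ^ p
  map_g : ∀ v, RatFn.functionFieldMap π (g v) =
    algebraMap (V.presheaf.stalk v) V.functionField (w v * ∏ i, u v i ^ a v i)
  /-- REG clause: with no charged coordinate the unit radicand is wound, or congruent to a `p`-th power
  modulo a parameter transversal to the boundary coordinates -/
  reg : ∀ v, (∀ i, a v i = 0) →
    (∀ x : V.presheaf.stalk v, w v - x ^ p ∉ maximalIdeal (V.presheaf.stalk v)) ∨
      (∃ x : V.presheaf.stalk v, w v - x ^ p ∈ maximalIdeal (V.presheaf.stalk v) ∧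
        w v - x ^ p ∉ maximalIdeal (V.presheaf.stalk v) ^ 2 ⊔
          Ideal.span (u v '' Set.range (lab v)))

namespace GameState

variable {p : ℕ} {V₀ : Scheme.{0}} [IsIntegral V₀] {L : Type} [Field L] [Algebra V₀.functionField L]
  {V : Scheme.{0}} [IsIntegral V] {π : V ⟶ V₀} [IsDominant π]
  (S : GameState p V₀ L V π)

/-! ## Measures -/

/-- The CHARGED coordinates at `v` (nonzero exponent, then prime to `p`). [folklore] -/
def ch (v : V) : Finset (Fin (S.d v)) :=
  Finset.univ.filter fun i => S.a v i ≠ 0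

/-- A coordinate is a BOUNDARY coordinate if it is the label of an exceptional divisor through `v`.
[folklore] -/
def IsLab (v : V) (i : Fin (S.d v)) : Prop :=
  i ∈ Set.range (S.lab v)

open Classical in
/-- The OLD charged coordinates at `v`: charged and not exceptional. [folklore] -/
def oldCh (v : V) : Finset (Fin (S.d v)) :=
  (S.ch v).filter fun i => ¬ S.IsLab v i

/-- `mOld v` = the number of old (non-exceptional) charged components through `v`. [folklore] -/
def mOld (v : V) : ℕ :=
  (S.oldCh v).card

open Classical in
/-- The exponent of the exceptional divisor `D` at `v` (`0` if `D ∉ E` or `v ∉ D`). [folklore] -/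
def expOf (D : V.IdealSheafData) (v : V) : ℕ :=
  if h : D ∈ S.E ∧ v ∈ D.support then S.a v (S.lab v ⟨D, h⟩) else 0

/-- The exceptional divisor `D` is CHARGED at `v`: it passes through `v` and its coordinate enters the
radicand. [folklore] -/
def chargedAt (D : V.IdealSheafData) (v : V) : Prop :=
  S.expOf D v ≠ 0

/-- The exponent of the old charged component at a point with `mOld v = 1` (the `sup` over the
singleton `oldCh v`). [folklore] -/
def oldExp (v : V) : ℕ :=
  (S.oldCh v).sup (S.a v)

/-- The phase-2 RESONANCE of the exceptional divisor `D` at `v`: the least `n ≥ 1` with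
`p ∣ e_D + n · a_H` (`e_D` the exponent of `D`, `a_H` that of the old charged component), capped at `p`
(so that it always lies in `[1, p]`; at a point of the bad locus of a charged `D` the cap is not attained).
[folklore] -/
def Nval (v : V) (D : V.IdealSheafData) : ℕ :=
  sInf {n : ℕ | 1 ≤ n ∧ (p ∣ S.expOf D v + n * S.oldExp v ∨ n = p)}

/-- The BAD LOCUS of the exceptional divisor `D`: points with exactly one old charged component where
`D` is charged (phase-2 centres are these, `D` by `D`). [folklore] -/
def W (D : V.IdealSheafData) : Set V :=
  {v | S.mOld v = 1 ∧ S.chargedAt D v}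

/-- The phase-2 POTENTIAL of the game state `T`: the sum over the exceptional divisors of the largest
resonance on their bad loci (`sSup ∅ = 0`). [folklore] -/
def Φ (T : GameState p V₀ L V π) : ℕ :=
  (T.E.map fun D => sSup ((fun v => T.Nval v D) '' T.W D)).sum

/-- **End state of the game state `T`**: at most one old charged component through any point, and none
where an exceptional divisor is charged. [folklore] -/
def EndCond (T : GameState p V₀ L V π) : Prop :=
  ∀ v, T.mOld v ≤ 1 ∧ (T.mOld v = 1 → ∀ D, ¬ T.chargedAt D v)

/-! ## Admissible centres and the contract of one round -/

/-- **Admissible centre**: a closed `Z ⊆ V` together with, at each of its points, a set `I` of at least two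
CHARGED coordinates such that the reduced ideal of `Z` has stalk `(u_i : i ∈ I)` there (so `Z` is regular
of codimension `|I|` and has normal crossings with the boundary and the old charged components).
[folklore] -/
structure Admissible (Z : Set V) (hZ : IsClosed Z) (I : ∀ v : V, v ∈ Z → Finset (Fin (S.d v))) :
    Prop where
  two_le : ∀ v hv, 2 ≤ (I v hv).card
  subset_ch : ∀ v hv, I v hv ⊆ S.ch v
  stalkIdeal_eq : ∀ v hv,
    stalkIdeal (Scheme.IdealSheafData.vanishingIdeal ⟨Z, hZ⟩) v = Ideal.span (S.u v '' (I v hv))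

/-- **The contract of one round.** `S'` is a state on the blow-up `φ : V' → V` of the admissible centre
`Z` (reduced ideal `C`): the new boundary is `E.map (strictTransformIdeal φ C) ++ [C·𝒪_{V'}]`, and at a
point `x ∈ V'` over `v`:
* (OFF) `v ∉ Z`: `mOld`, the charges of the (strict transforms of the) old divisors and the resonances are
  unchanged, and the new exceptional divisor is absent;
* (OVER) `v ∈ Z`: `mOld x ≤ mOld v`;
* (P1) `v ∈ Z` and the centre consists of ALL old charged coordinates at `v` (phase 1): `mOld x < mOld v`;
* (P2) `v ∈ Z`, `mOld v = 1` and the centre is `{old, D₀}` for an exceptional `D₀` charged at `v`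
  (phase 2): if `mOld x = 1` then `D₀`'s strict transform is not charged at `x`, the other old divisors
  keep charge and resonance, and the new exceptional divisor, if charged at `x`, has resonance
  `Nval v D₀ - 1`.
[folklore] -/
structure RoundSpec (Z : Set V) (hZ : IsClosed Z) (I : ∀ v : V, v ∈ Z → Finset (Fin (S.d v)))
    {V' : Scheme.{0}} [IsIntegral V'] (φ : V' ⟶ V) [IsDominant (φ ≫ π)]
    (S' : GameState p V₀ L V' (φ ≫ π)) : Prop where
  E_eq : S'.E = S.E.map (strictTransformIdeal φ (Scheme.IdealSheafData.vanishingIdeal ⟨Z, hZ⟩)) ++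
    [(Scheme.IdealSheafData.vanishingIdeal ⟨Z, hZ⟩).comap φ]
  off_mOld : ∀ x, φ x ∉ Z → S'.mOld x = S.mOld (φ x)
  off_charged : ∀ x, φ x ∉ Z → ∀ D ∈ S.E,
    (S'.chargedAt (strictTransformIdeal φ (Scheme.IdealSheafData.vanishingIdeal ⟨Z, hZ⟩) D) x ↔
      S.chargedAt D (φ x))
  off_exc : ∀ x, φ x ∉ Z → ¬ S'.chargedAt ((Scheme.IdealSheafData.vanishingIdeal ⟨Z, hZ⟩).comap φ) x
  off_Nval : ∀ x, φ x ∉ Z → ∀ D ∈ S.E, S.chargedAt D (φ x) →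
    S'.Nval x (strictTransformIdeal φ (Scheme.IdealSheafData.vanishingIdeal ⟨Z, hZ⟩) D) =
      S.Nval (φ x) D
  p1 : ∀ x (hx : φ x ∈ Z), I (φ x) hx = S.oldCh (φ x) → S'.mOld x < S.mOld (φ x)
  over_mOld_le : ∀ x, φ x ∈ Z → S'.mOld x ≤ S.mOld (φ x)
  p2 : ∀ x (hx : φ x ∈ Z) (D₀ : {D : V.IdealSheafData // D ∈ S.E ∧ φ x ∈ D.support}),
    S.mOld (φ x) = 1 → S.chargedAt D₀.1 (φ x) →
    I (φ x) hx = S.oldCh (φ x) ∪ {S.lab (φ x) D₀} → S'.mOld x = 1 →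
      ¬ S'.chargedAt (strictTransformIdeal φ (Scheme.IdealSheafData.vanishingIdeal ⟨Z, hZ⟩) D₀.1) x ∧
      (∀ D ∈ S.E, D ≠ D₀.1 →
        (S'.chargedAt (strictTransformIdeal φ (Scheme.IdealSheafData.vanishingIdeal ⟨Z, hZ⟩) D) x ↔
          S.chargedAt D (φ x)) ∧
        (S.chargedAt D (φ x) →
          S'.Nval x (strictTransformIdeal φ (Scheme.IdealSheafData.vanishingIdeal ⟨Z, hZ⟩) D) =
            S.Nval (φ x) D)) ∧
      (S'.chargedAt ((Scheme.IdealSheafData.vanishingIdeal ⟨Z, hZ⟩).comap φ) x →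
        S'.Nval x ((Scheme.IdealSheafData.vanishingIdeal ⟨Z, hZ⟩).comap φ) + 1 = S.Nval (φ x) D₀.1)

/-! ## Elementary consequences of the definitions -/

/-- A divisor charged at some point is a member of `E`. [folklore] -/
theorem mem_E_of_chargedAt {D : V.IdealSheafData} {v : V} (h : S.chargedAt D v) : D ∈ S.E := by
  unfold chargedAt expOf at h
  by_contra hD
  exact h (by rw [dif_neg (fun h' => hD h'.1)])

/-- A divisor charged at `v` passes through `v`. [folklore] -/
theorem mem_support_of_chargedAt {D : V.IdealSheafData} {v : V} (h : S.chargedAt D v) :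
    v ∈ D.support := by
  unfold chargedAt expOf at h
  by_contra hD
  exact h (by rw [dif_neg (fun h' => hD h'.2)])

/-- The resonance lies in `[1, p]` (for `p ≥ 1`). [folklore] -/
theorem one_le_Nval_and_le (hp : 1 ≤ p) (v : V) (D : V.IdealSheafData) :
    1 ≤ S.Nval v D ∧ S.Nval v D ≤ p := by
  have hmem : p ∈ {n : ℕ | 1 ≤ n ∧ (p ∣ S.expOf D v + n * S.oldExp v ∨ n = p)} := ⟨hp, Or.inr rfl⟩
  have hne : {n : ℕ | 1 ≤ n ∧ (p ∣ S.expOf D v + n * S.oldExp v ∨ n = p)}.Nonempty := ⟨p, hmem⟩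
  constructor
  · exact (Nat.sInf_mem hne).1
  · exact Nat.sInf_le hmem

/-- The sets of resonances on a bad locus are bounded by `p`. [folklore] -/
theorem bddAbove_Nval_image (hp : 1 ≤ p) (D : V.IdealSheafData) (T : Set V) :
    BddAbove ((fun v => S.Nval v D) '' T) := by
  refine ⟨p, ?_⟩
  rintro _ ⟨v, -, rfl⟩
  exact (S.one_le_Nval_and_le hp v D).2

/-- If `mOld ≤ 1` everywhere and the end condition fails, some exceptional divisor is charged at a point
with `mOld = 1`. [folklore] -/
theorem exists_chargedAt_of_not_endCond (h1 : ∀ v, S.mOld v ≤ 1) (h : ¬ S.EndCond) :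
    ∃ v D, S.mOld v = 1 ∧ S.chargedAt D v := by
  unfold EndCond at h
  push Not at h
  obtain ⟨v, hv⟩ := h
  obtain ⟨h2, D, hD⟩ := hv (h1 v)
  exact ⟨v, D, h2, hD⟩

end GameState

end Summit.ResolutionOfSingularities.ResolutionOfSingularities.Theorems.RadicialJung.CleanModelsSuffice

end
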